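import Literature.GroupTheory.CombinatorialGroupTheory.RandomSclFreeGroupNextBig
import Literature.GroupTheory.CombinatorialGroupTheory.RandomSclFreeGroupOrbitData
import HarnessLib

/-!
# Random rigidity of scl (Calegari–Walker 2013): proofs, part 33 — the fan token structure of a
pairing (tokens, successor, partner), pair level

D. Calegari, A. Walker, *Random rigidity in the free group*, Geom. Topol. 17 (2013)
[CalegariWalker2013], §4.4. The resolved (trivalent) boundary of the fatgraph of a pairing, with
every vertex of valence `r ≥ 4` split by the fan of diagonals from its apex, as a token structure
(parts 27–29) on pairs `(x, s)`: `x` a big corner, `s ≤ ff x` a slot (`s < ff x` fake sides,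
`s = ff x` the real side leaving `x`), where `ff (q_0) = r − 3`, `ff (q_i) = 1` for `2 ≤ i ≤ r−2`,
`ff = 0` otherwise (`q_i = τ^i apex`). Successor `Sf (x, s) = (x, s+1)` if `s < ff x`, else
`(next x, 0)`; predecessor `Sb`; partner `Pf`: real ↦ real at `zcor x`; fake `(q_i, 0)` ↦
`(q_0, r−2−i)`; apex fake `(q_0, s)` ↦ `(q_{r−2−s}, 0)`. All functions are passed as parameters
with their defining equations.

* **`fan_Sb_Sf`, `fan_Sf_Sb`** — `Sb` and `Sf` are inverse on valid pairs.
* **`fan_Pf_Pf`** — `Pf` is an involution; **`fan_len_Pf`** — it preserves lengths.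
* **`fan_trivalent`** — `Pf (Sf (Pf p)) = Sb (Pf (Sb p))`.
-/

noncomputable section

namespace Literature.GroupTheory.CombinatorialGroupTheory

section FanTokens

open Equiv

variable {N : ℕ} (π : Equiv.Perm (Fin N)) (hπ : ∀ y, π (π y) = y) (g : Fin N → ℕ)
  (hg : ∀ x, ((finRotate N).trans π) (((finRotate N).trans π) x) ≠ x →
    1 ≤ g x ∧ (∀ j, 1 ≤ j → j ≤ g x - 1 →
      ((finRotate N).trans π) (((finRotate N).trans π) (((finRotate N) ^ j) x)) = ((finRotate N) ^ j) x) ∧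
    ((finRotate N).trans π) (((finRotate N).trans π) (((finRotate N) ^ (g x)) x)) ≠ ((finRotate N) ^ (g x)) x)
  (apex : Fin N → Fin N) (ind rr : Fin N → ℕ)
  (hrr3 : ∀ x, ((finRotate N).trans π) (((finRotate N).trans π) x) ≠ x → 3 ≤ rr x)
  (hind : ∀ x, ((finRotate N).trans π) (((finRotate N).trans π) x) ≠ x →
    ind x < rr x ∧ (((finRotate N).trans π) ^ (ind x)) (apex x) = x)
  (hper : ∀ x, ((finRotate N).trans π) (((finRotate N).trans π) x) ≠ x → ∀ m n : ℕ,
    (((finRotate N).trans π) ^ m) (apex x) = (((finRotate N).trans π) ^ n) (apex x) ↔ m % rr x = n % rr x)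
  (hpow : ∀ x, ((finRotate N).trans π) (((finRotate N).trans π) x) ≠ x → ∀ i : ℕ,
    apex ((((finRotate N).trans π) ^ i) (apex x)) = apex x ∧
    rr ((((finRotate N).trans π) ^ i) (apex x)) = rr x ∧
    ((finRotate N).trans π) (((finRotate N).trans π) ((((finRotate N).trans π) ^ i) (apex x))) ≠
      (((finRotate N).trans π) ^ i) (apex x) ∧
    ind ((((finRotate N).trans π) ^ i) (apex x)) = i % rr x)
  -- the derived functions, with their defining equations
  (ff : Fin N → ℕ)
  (hff : ∀ x, ff x = if ind x = 0 then rr x - 3 else if 2 ≤ ind x ∧ ind x ≤ rr x - 2 then 1 else 0)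
  (nx zc pv : Fin N → Fin N)
  (hnx : ∀ x, nx x = ((finRotate N) ^ (g x)) x)
  (hzc : ∀ x, zc x = ((finRotate N).symm ^ (g x)) (((finRotate N).trans π) x))
  (hpv : ∀ x, pv x = ((finRotate N).symm ^ (g (((finRotate N).trans π).symm x)))
    (((finRotate N).trans π) (((finRotate N).trans π).symm x)))
  (qc : Fin N → ℕ → Fin N) (hqc : ∀ x i, qc x i = (((finRotate N).trans π) ^ i) (apex x))
  (Sf Sb Pf : Fin N × ℕ → Fin N × ℕ)
  (hSf : ∀ p, Sf p = if p.2 < ff p.1 then (p.1, p.2 + 1) else (nx p.1, 0))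
  (hSb : ∀ p, Sb p = if 0 < p.2 then (p.1, p.2 - 1) else (pv p.1, ff (pv p.1)))
  (hPf : ∀ p, Pf p = if p.2 = ff p.1 then (zc p.1, ff (zc p.1)) else
    if ind p.1 = 0 then (qc p.1 (rr p.1 - 2 - p.2), 0) else (apex p.1, rr p.1 - 2 - ind p.1))

include hπ hg hnx hzc hpv in
/-- `next`, `zcor`, `prev` of a big corner are big.
(Arguments: `π hπ g hg nx zc pv hnx hzc hpv hx`.) [folklore] -/
theorem fan_big_nx_zc_pv {x : Fin N} (hx : ((finRotate N).trans π) (((finRotate N).trans π) x) ≠ x) :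
    ((finRotate N).trans π) (((finRotate N).trans π) (nx x)) ≠ nx x ∧
    ((finRotate N).trans π) (((finRotate N).trans π) (zc x)) ≠ zc x ∧
    ((finRotate N).trans π) (((finRotate N).trans π) (pv x)) ≠ pv x := by
  refine ⟨?_, ?_, ?_⟩
  · rw [hnx]; exact (hg x hx).2.2
  · rw [hzc]; exact big_zcor π hπ g hg hx
  · rw [hpv]; exact big_zcor π hπ g hg (big_tau_symm π hx)

include hπ hg hnx hpv in
/-- `pv (nx x) = x` and `nx (pv x) = x`. (Arguments: `π hπ g hg nx pv hnx hpv hx`.) [folklore] -/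
theorem fan_pv_nx {x : Fin N} (hx : ((finRotate N).trans π) (((finRotate N).trans π) x) ≠ x) :
    pv (nx x) = x ∧ nx (pv x) = x := by
  constructor
  · rw [hpv, hnx]; exact prev_next π hπ g hg hx
  · rw [hnx, hpv]; exact next_prev π hπ g hg hx

include hrr3 hind hper hpow hqc in
/-- **Corner API.** (Arguments: `π apex ind rr hrr3 hind hper hpow qc hqc hx`.) For a big `x`: `qc x (ind x) = x`; the corners `qc x i` are big with the
same apex and size and index `i % rr x`; `τ (qc x i) = qc x (i+1)`; periodicity; and the values
of `ff` along the orbit. [folklore] -/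
theorem fan_corner_api {x : Fin N} (hx : ((finRotate N).trans π) (((finRotate N).trans π) x) ≠ x) :
    qc x (ind x) = x ∧
    (∀ i, ((finRotate N).trans π) (((finRotate N).trans π) (qc x i)) ≠ qc x i ∧
      apex (qc x i) = apex x ∧ rr (qc x i) = rr x ∧ ind (qc x i) = i % rr x) ∧
    (∀ i, ((finRotate N).trans π) (qc x i) = qc x (i + 1)) ∧
    (∀ i j, qc x i = qc x j ↔ i % rr x = j % rr x) ∧
    (∀ i, qc x (i + rr x) = qc x i) ∧
    (∀ y i, apex y = apex x → qc y i = qc x i) ∧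
    apex x = qc x 0 ∧
    (((finRotate N).trans π).symm x = qc x (ind x + rr x - 1)) := by
  have h1 : qc x (ind x) = x := by rw [hqc]; exact (hind x hx).2
  refine ⟨h1, ?_, ?_, ?_, ?_, ?_, ?_, ?_⟩
  · intro i
    obtain ⟨ha, hr, hb, hi⟩ := hpow x hx i
    rw [hqc]
    exact ⟨hb, ha, hr, hi⟩
  · intro i; rw [hqc, hqc, pow_succ', Equiv.Perm.mul_apply]
  · intro i j; rw [hqc, hqc]; exact hper x hx i j
  · intro i; rw [hqc, hqc, hper x hx]; simp
  · intro y i hy; rw [hqc, hqc, hy]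
  · rw [hqc, pow_zero, Equiv.Perm.one_apply]
  · rw [Equiv.symm_apply_eq, hqc]
    have hr := hrr3 x hx
    conv_lhs => rw [← h1, hqc]
    rw [← Equiv.Perm.mul_apply, ← pow_succ', show ind x + rr x - 1 + 1 = ind x + rr x by omega,
      hper x hx]
    simp


include hπ hg hnx hpv hSf hSb in
/-- **`Sb (Sf p) = p` and `Sf (Sb p) = p` on valid pairs.**
(Arguments: `π hπ g hg ff nx pv hnx hpv Sf Sb hSf hSb hp`.) [folklore] -/
theorem fan_Sb_Sf_Sb {p : Fin N × ℕ}
    (hp : ((finRotate N).trans π) (((finRotate N).trans π) p.1) ≠ p.1 ∧ p.2 ≤ ff p.1) :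
    Sb (Sf p) = p ∧ Sf (Sb p) = p := by
  obtain ⟨x, s⟩ := p
  obtain ⟨hx, hs⟩ := hp
  simp only at hx hs
  have hpn := fan_pv_nx π hπ g hg nx pv hnx hpv hx
  constructor
  · rw [hSf]
    by_cases h : s < ff x
    · simp only [if_pos h]
      rw [hSb]
      simp only [Nat.succ_pos', if_true, Nat.add_sub_cancel]
    · simp only [if_neg h]
      rw [hSb]
      simp only [lt_irrefl, if_false]
      rw [hpn.1]
      have : s = ff x := by omega
      rw [this]
  · rw [hSb]
    by_cases h : 0 < s
    · simp only [if_pos h]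
      rw [hSf]
      simp only
      rw [if_pos (by omega), Nat.sub_add_cancel h]
    · simp only [if_neg h]
      rw [hSf]
      simp only [lt_irrefl, if_false]
      rw [hpn.2]
      have : s = 0 := by omega
      rw [this]

include hπ hg hnx hzc hpv hSf hSb in
/-- **`Sf` and `Sb` preserve validity.**
(Arguments: `π hπ g hg ff nx zc pv hnx hzc hpv Sf Sb hSf hSb hp`.) [folklore] -/
theorem fan_valid_Sf_Sb {p : Fin N × ℕ}
    (hp : ((finRotate N).trans π) (((finRotate N).trans π) p.1) ≠ p.1 ∧ p.2 ≤ ff p.1) :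
    (((finRotate N).trans π) (((finRotate N).trans π) (Sf p).1) ≠ (Sf p).1 ∧ (Sf p).2 ≤ ff (Sf p).1) ∧
    (((finRotate N).trans π) (((finRotate N).trans π) (Sb p).1) ≠ (Sb p).1 ∧ (Sb p).2 ≤ ff (Sb p).1) := by
  obtain ⟨x, s⟩ := p
  obtain ⟨hx, hs⟩ := hp
  simp only at hx hs
  have hb := fan_big_nx_zc_pv π hπ g hg nx zc pv hnx hzc hpv hx
  constructor
  · rw [hSf]
    by_cases h : s < ff x
    · simp only [if_pos h]; exact ⟨hx, h⟩
    · simp only [if_neg h]; exact ⟨hb.1, Nat.zero_le _⟩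
  · rw [hSb]
    by_cases h : 0 < s
    · simp only [if_pos h]; exact ⟨hx, by omega⟩
    · simp only [if_neg h]; exact ⟨hb.2.2, le_rfl⟩

include hπ hg hrr3 hind hper hpow hff hnx hzc hpv hqc hPf in
/-- **`Pf` is an involution preserving validity and lengths** (`len (x, s) = g x` if `s = ff x`,
else `0`). (Arguments: `π hπ g hg apex ind rr hrr3 hind hper hpow ff hff nx zc pv hnx hzc hpv qc hqc
Pf hPf hp`.) [cite: CalegariWalker2013, §4.4] -/
theorem fan_Pf_Pf {p : Fin N × ℕ}
    (hp : ((finRotate N).trans π) (((finRotate N).trans π) p.1) ≠ p.1 ∧ p.2 ≤ ff p.1) :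
    (((finRotate N).trans π) (((finRotate N).trans π) (Pf p).1) ≠ (Pf p).1 ∧ (Pf p).2 ≤ ff (Pf p).1) ∧
    Pf (Pf p) = p ∧
    ((if (Pf p).2 = ff (Pf p).1 then g (Pf p).1 else 0) = (if p.2 = ff p.1 then g p.1 else 0)) := by
  obtain ⟨x, s⟩ := p
  obtain ⟨hx, hs⟩ := hp
  simp only at hx hs
  obtain ⟨hq1, hq2, hq3, hq4, hq5, hq6, hq7, hq8⟩ :=
    fan_corner_api π apex ind rr hrr3 hind hper hpow qc hqc hx
  have hb := fan_big_nx_zc_pv π hπ g hg nx zc pv hnx hzc hpv hx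
  have hr := hrr3 x hx
  have hil := (hind x hx).1
  by_cases hreal : s = ff x
  · -- real token
    subst hreal
    have hP : Pf (x, ff x) = (zc x, ff (zc x)) := by rw [hPf]; simp
    rw [hP]
    have hzz : zc (zc x) = x := by rw [hzc, hzc]; exact zcor_zcor π hπ g hg hx
    have hP2 : Pf (zc x, ff (zc x)) = (zc (zc x), ff (zc (zc x))) := by rw [hPf]; simp
    refine ⟨⟨hb.2.1, le_rfl⟩, ?_, ?_⟩
    · rw [hP2, hzz]
    · simp only [if_true]
      rw [hzc]; exact gap_zcor π hπ g hg hx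
  · have hslt : s < ff x := by omega
    by_cases hi0 : ind x = 0
    · -- apex fake: `ff x = rr x - 3`, partner `(qc x (rr x - 2 - s), 0)`
      have hffx : ff x = rr x - 3 := by rw [hff, if_pos hi0]
      have hP : Pf (x, s) = (qc x (rr x - 2 - s), 0) := by
        rw [hPf]; simp only; rw [if_neg hreal, if_pos hi0]
      rw [hP]
      set j := rr x - 2 - s with hj
      have hj2 : 2 ≤ j ∧ j ≤ rr x - 2 := by omega
      obtain ⟨hbj, haj, hrj, hij⟩ := hq2 j
      have hijv : ind (qc x j) = j := by rw [hij, Nat.mod_eq_of_lt (by omega)]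
      have hffj : ff (qc x j) = 1 := by
        rw [hff, hijv, if_neg (by omega), if_pos (by omega)]
      have hP2 : Pf (qc x j, 0) = (apex (qc x j), rr (qc x j) - 2 - ind (qc x j)) := by
        rw [hPf]; simp only; rw [hffj, if_neg (by omega), hijv, if_neg (by omega)]
      refine ⟨⟨hbj, by rw [hffj]; omega⟩, ?_, ?_⟩
      · rw [hP2, haj, hrj, hijv]
        -- `apex x = x` since `ind x = 0`
        have hax : apex x = x := by rw [hq7, ← hi0, hq1]
        rw [hax]
        congr 1
        omega
      · simp only
        rw [hffj, if_neg (by omega), if_neg hreal]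
    · -- middle fake: `ff x = 1`, `s = 0`, partner `(apex x, rr x - 2 - ind x)`
      have hffx : ff x = 1 := by
        rw [hff, if_neg hi0]
        split_ifs with h
        · rfl
        · rw [hff, if_neg hi0, if_neg h] at hslt; omega
      have hi2 : 2 ≤ ind x ∧ ind x ≤ rr x - 2 := by
        by_contra h
        rw [hff, if_neg hi0, if_neg h] at hffx; omega
      have hs0 : s = 0 := by omega
      subst hs0
      have hP : Pf (x, 0) = (apex x, rr x - 2 - ind x) := by
        rw [hPf]; simp only; rw [hffx, if_neg (by omega), if_neg hi0]
      rw [hP]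
      obtain ⟨hb0, ha0, hr0, hi00⟩ := hq2 0
      rw [← hq7] at hb0 ha0 hr0 hi00
      rw [Nat.zero_mod] at hi00
      have hffa : ff (apex x) = rr x - 3 := by rw [hff, hi00, if_pos rfl, hr0]
      have hP2 : Pf (apex x, rr x - 2 - ind x) = (qc (apex x) (rr (apex x) - 2 - (rr x - 2 - ind x)), 0) := by
        rw [hPf]; simp only; rw [hffa, if_neg (by omega), hi00, if_pos rfl]
      refine ⟨⟨hb0, by rw [hffa]; omega⟩, ?_, ?_⟩
      · rw [hP2, hr0, hq6 (apex x) _ ha0, show rr x - 2 - (rr x - 2 - ind x) = ind x by omega, hq1]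
      · simp only
        rw [hffa, if_neg (by omega), hffx]
        simp


include hnx hSf in
/-- **Consecutivity.** (Arguments: `π g ff nx hnx Sf hSf hN hp`.) `start (Sf p) ≡ start p + len p (mod N)` with `start (x, s) = (x + 1) % N`.
[folklore] -/
theorem fan_consecutive (hN : 0 < N) {p : Fin N × ℕ}
    (hp : ((finRotate N).trans π) (((finRotate N).trans π) p.1) ≠ p.1 ∧ p.2 ≤ ff p.1) :
    (((Sf p).1 : ℕ) + 1) % N = (((p.1 : ℕ) + 1) % N + (if p.2 = ff p.1 then g p.1 else 0)) % N := by
  obtain ⟨x, s⟩ := p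
  obtain ⟨hx, hs⟩ := hp
  simp only at hx hs ⊢
  rw [hSf]
  by_cases h : s < ff x
  · simp only [if_pos h, if_neg (show s ≠ ff x by omega), Nat.add_zero, Nat.mod_mod]
  · simp only [if_neg h, if_pos (show s = ff x by omega)]
    rw [hnx, val_finRotate_pow hN, Nat.mod_add_mod, Nat.mod_add_mod]
    congr 1; ring

include hπ hg hzc hPf in
/-- **The word axiom for the fan tokens.** (Arguments: `π hπ g hg ff zc hzc Pf hPf hN inv Wl vg hNn
hpair hWv hp j hj`.) If the letters `Wl` satisfy `Wl (π y) = inv (Wl y)`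
and are read in `vg` at offset `off` with period `n′ ∣ N`, then for a real token `(x, ff x)` and
`j < g x`: `vg (off + (start (Pf (x, ff x)) + j) % n′) = inv (vg (off + (start (x, ff x) +
(g x − 1 − j)) % n′))`. [cite: CalegariWalker2013, §4.4 (the two sides of an edge are inverse)] -/
theorem fan_word (hN : 0 < N) {A : Type*} (inv : A → A) (Wl : Fin N → A) (vg : ℕ → A)
    {n' off : ℕ} (hNn : n' ∣ N) (hpair : ∀ y, Wl (π y) = inv (Wl y))
    (hWv : ∀ y : Fin N, Wl y = vg (off + (y : ℕ) % n')) {p : Fin N × ℕ}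
    (hp : ((finRotate N).trans π) (((finRotate N).trans π) p.1) ≠ p.1 ∧ p.2 ≤ ff p.1)
    (j : ℕ) (hj : j < (if p.2 = ff p.1 then g p.1 else 0)) :
    vg (off + ((((Pf p).1 : ℕ) + 1) % N + j) % n') =
      inv (vg (off + ((((p.1 : ℕ) + 1) % N) + ((if p.2 = ff p.1 then g p.1 else 0) - 1 - j)) % n')) := by
  obtain ⟨x, s⟩ := p
  obtain ⟨hx, hs⟩ := hp
  simp only at hx hs hj ⊢
  by_cases hreal : s = ff x
  swap
  · rw [if_neg hreal] at hj; omega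
  rw [if_pos hreal] at hj ⊢
  subst hreal
  have hP : Pf (x, ff x) = (zc x, ff (zc x)) := by rw [hPf]; simp
  rw [hP]
  simp only
  obtain ⟨hg1, hbiv, _⟩ := hg x hx
  -- the two letters: `σ^{j+1} (zc x)` and `σ^{g x - j} x`, partners under `π`
  have hshift := pairing_pow_shift π hπ x (g x) hbiv (g x - j) (by omega) (by omega)
  -- `σ.symm^{g x - j - 1} (τ x) = σ^{j+1} (zc x)`
  have hz : ((finRotate N).symm ^ (g x - j - 1)) (((finRotate N).trans π) x) =
      ((finRotate N) ^ (j + 1)) (zc x) := by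
    rw [hzc, pow_apply_symm_pow _ (by omega : j + 1 ≤ g x),
      show g x - (j + 1) = g x - j - 1 by omega]
  rw [hz] at hshift
  -- letters
  have hl : Wl (((finRotate N) ^ (j + 1)) (zc x)) = inv (Wl (((finRotate N) ^ (g x - j)) x)) := by
    rw [← hshift, hpair]
  rw [hWv, hWv, val_finRotate_pow hN, val_finRotate_pow hN, Nat.mod_mod_of_dvd _ hNn,
    Nat.mod_mod_of_dvd _ hNn] at hl
  have e1 : (((zc x : ℕ) + 1) % N + j) % n' = ((zc x : ℕ) + (j + 1)) % n' := by
    rw [← Nat.mod_mod_of_dvd (((zc x : ℕ) + 1) % N + j) hNn, Nat.mod_add_mod,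
      Nat.mod_mod_of_dvd _ hNn]
    congr 1; ring
  have e2 : (((x : ℕ) + 1) % N + (g x - 1 - j)) % n' = ((x : ℕ) + (g x - j)) % n' := by
    rw [← Nat.mod_mod_of_dvd (((x : ℕ) + 1) % N + (g x - 1 - j)) hNn, Nat.mod_add_mod,
      Nat.mod_mod_of_dvd _ hNn]
    congr 1; omega
  rw [e1, e2]
  exact hl


set_option maxHeartbeats 1600000 in
include hπ hg hrr3 hind hper hpow hff hnx hzc hpv hqc hSf hSb hPf in
/-- **Trivalence of the fan token structure:** `Pf (Sf (Pf p)) = Sb (Pf (Sb p))` for every valid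
pair `p` — the resolved fatgraph is trivalent, so the side after the partner of a side and the
side before it are partners. (Arguments: `π hπ g hg apex ind rr hrr3 hind hper hpow ff hff nx zc pv
hnx hzc hpv qc hqc Sf Sb Pf hSf hSb hPf hp`.)
[cite: CalegariWalker2013, §4.4 ("we artificially split open vertices of higher valence")] -/
theorem fan_trivalent {p : Fin N × ℕ}
    (hp : ((finRotate N).trans π) (((finRotate N).trans π) p.1) ≠ p.1 ∧ p.2 ≤ ff p.1) :
    Pf (Sf (Pf p)) = Sb (Pf (Sb p)) := by
  obtain ⟨x, s⟩ := p
  obtain ⟨hx, hs⟩ := hp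
  simp only at hx hs
  obtain ⟨hq1, hq2, hq3, hq4, hq5, hq6, hq7, hq8⟩ :=
    fan_corner_api π apex ind rr hrr3 hind hper hpow qc hqc hx
  have hr := hrr3 x hx
  have hil := (hind x hx).1
  -- evaluation of the three maps
  have hP_real : ∀ y, Pf (y, ff y) = (zc y, ff (zc y)) := by intro y; rw [hPf]; simp
  have hP_fake : ∀ y t, t < ff y → Pf (y, t) =
      if ind y = 0 then (qc y (rr y - 2 - t), 0) else (apex y, rr y - 2 - ind y) := by
    intro y t ht; rw [hPf]; simp only; rw [if_neg (ne_of_lt ht)]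
  have hS_fake : ∀ y t, t < ff y → Sf (y, t) = (y, t + 1) := by
    intro y t ht; rw [hSf]; simp only; rw [if_pos ht]
  have hS_real : ∀ y, Sf (y, ff y) = (nx y, 0) := by
    intro y; rw [hSf]; simp
  have hB_pos : ∀ y t, 0 < t → Sb (y, t) = (y, t - 1) := by
    intro y t ht; rw [hSb]; simp only; rw [if_pos ht]
  have hB_zero : ∀ y, Sb (y, 0) = (pv y, ff (pv y)) := by
    intro y; rw [hSb]; simp
  -- corner identities
  have nx_zc : ∀ y, ((finRotate N).trans π) (((finRotate N).trans π) y) ≠ y →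
      nx (zc y) = ((finRotate N).trans π) y := by
    intro y hy; rw [hnx, hzc]; exact next_zcor π hπ g hg hy
  have pv_eq : ∀ y, pv y = zc (((finRotate N).trans π).symm y) := by
    intro y; rw [hpv, hzc]
  have zc_pv : ∀ y, ((finRotate N).trans π) (((finRotate N).trans π) y) ≠ y →
      zc (pv y) = ((finRotate N).trans π).symm y := by
    intro y hy
    have := zcor_zcor π hπ g hg (big_tau_symm π hy)
    rw [← hpv y] at this
    rw [hzc]; exact this
  have tsymm_qc : ∀ m, ((finRotate N).trans π).symm (qc x (m + 1)) = qc x m := by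
    intro m; rw [Equiv.symm_apply_eq]; exact (hq3 m).symm
  have hffq : ∀ m, ff (qc x m) = if m % rr x = 0 then rr x - 3 else
      if 2 ≤ m % rr x ∧ m % rr x ≤ rr x - 2 then 1 else 0 := by
    intro m; rw [hff, (hq2 m).2.2.2, (hq2 m).2.2.1]
  have hindq : ∀ m, ind (qc x m) = m % rr x := fun m => (hq2 m).2.2.2
  have hrrq : ∀ m, rr (qc x m) = rr x := fun m => (hq2 m).2.2.1
  have hapq : ∀ m, apex (qc x m) = qc x 0 := fun m => by rw [(hq2 m).2.1, hq7]
  have hqq : ∀ m j, qc (qc x m) j = qc x j := fun m j => hq6 _ _ (hq2 m).2.1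
  have hbq : ∀ m, ((finRotate N).trans π) (((finRotate N).trans π) (qc x m)) ≠ qc x m :=
    fun m => (hq2 m).1
  -- `x`, `τ x`, `τ⁻¹ x` as orbit corners
  have hx_eq : x = qc x (ind x) := hq1.symm
  have htx : ((finRotate N).trans π) x = qc x (ind x + 1) := by
    conv_lhs => rw [hx_eq]
    exact hq3 _
  have htsx : ((finRotate N).trans π).symm x = qc x (ind x + rr x - 1) := hq8
  have hffx : ff x = if ind x = 0 then rr x - 3 else
      if 2 ≤ ind x ∧ ind x ≤ rr x - 2 then 1 else 0 := hff x
  -- periodic reductions of indices used below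
  have hper0 : qc x (rr x) = qc x 0 := by have := hq5 0; rwa [Nat.zero_add] at this
  ---------------------------------------------------------------- the case analysis
  by_cases hreal : s = ff x
  · ----- real token
    subst hreal
    -- LHS = Pf (τ x, 0) = Pf (qc x (ind x + 1), 0)
    have hL : Pf (Sf (Pf (x, ff x))) = Pf (qc x (ind x + 1), 0) := by
      rw [hP_real, hS_real, nx_zc x hx, htx]
    rw [hL]
    by_cases hff0 : ff x = 0
    · -- RHS = Sb (τ⁻¹ x, ff (τ⁻¹ x))
      have hR : Sb (Pf (Sb (x, ff x))) =
          Sb (qc x (ind x + rr x - 1), ff (qc x (ind x + rr x - 1))) := by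
        rw [hff0, hB_zero, hP_real, zc_pv x hx, htsx]
      rw [hR]
      by_cases hr3 : rr x = 3
      · -- valence 3: everything real
        have hff3 : ∀ m, ff (qc x m) = 0 := by
          intro m; rw [hffq m, hr3]
          have := Nat.mod_lt m (show 0 < 3 by norm_num)
          split_ifs <;> omega
        rw [hff3, hB_zero, pv_eq, ← hff3 (ind x + 1), hP_real]
        have e : qc x (ind x + rr x - 1) = qc x ((ind x + 1) + 1) := by
          rw [hq4, hr3]; omega
        rw [e, tsymm_qc]
      · have hr4 : 4 ≤ rr x := by omega
        -- `ff x = 0` with `rr x ≥ 4`: `ind x = 1` or `ind x = rr x - 1`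
        have hi : ind x = 1 ∨ ind x = rr x - 1 := by
          rw [hffx] at hff0; split_ifs at hff0 <;> omega
        rcases hi with hi | hi
        · -- `ind x = 1`
          rw [hi]
          have hff2 : ff (qc x 2) = 1 := by
            rw [hffq, Nat.mod_eq_of_lt (by omega)]; rw [if_neg (by omega), if_pos (by omega)]
          have e1 : qc x (1 + rr x - 1) = qc x 0 := by
            rw [show 1 + rr x - 1 = rr x by omega, hper0]
          have hff00 : ff (qc x 0) = rr x - 3 := by rw [hffq, Nat.zero_mod, if_pos rfl]
          rw [hP_fake _ _ (by rw [hff2]; omega), hindq, Nat.mod_eq_of_lt (by omega),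
            if_neg (by omega), hapq, hrrq, e1, hff00, hB_pos _ _ (by omega)]
          ext <;> simp; omega
        · -- `ind x = rr x - 1`
          rw [hi, show rr x - 1 + 1 = rr x by omega, hper0]
          have hff00 : ff (qc x 0) = rr x - 3 := by rw [hffq, Nat.zero_mod, if_pos rfl]
          have e1 : qc x (rr x - 1 + rr x - 1) = qc x (rr x - 2) := by
            rw [hq4]; rw [show rr x - 1 + rr x - 1 = (rr x - 2) + rr x by omega, Nat.add_mod_right]
          have hffm : ff (qc x (rr x - 2)) = 1 := by
            rw [hffq, Nat.mod_eq_of_lt (by omega), if_neg (by omega), if_pos (by omega)]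
          rw [hP_fake _ _ (by rw [hff00]; omega), hindq, Nat.zero_mod, if_pos rfl, hqq, hrrq,
            Nat.sub_zero, e1, hffm, hB_pos _ _ Nat.one_pos]
    · -- `ff x ≥ 1`: `ind x = 0 ∧ rr x ≥ 4`, or `2 ≤ ind x ≤ rr x - 2`
      have hffpos : 0 < ff x := Nat.pos_of_ne_zero hff0
      rw [hB_pos _ _ hffpos]
      by_cases hi0 : ind x = 0
      · have hffv : ff x = rr x - 3 := by rw [hffx, if_pos hi0]
        have hr4 : 4 ≤ rr x := by omega
        rw [hi0, Nat.zero_add]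
        have hff1 : ff (qc x 1) = 0 := by
          rw [hffq, Nat.mod_eq_of_lt (by omega), if_neg (by omega), if_neg (by omega)]
        have hff2 : ff (qc x 2) = 1 := by
          rw [hffq, Nat.mod_eq_of_lt (by omega), if_neg (by omega), if_pos (by omega)]
        -- LHS: `(qc x 1, 0)` is real
        have e1 : ((qc x 1, 0) : Fin N × ℕ) = (qc x 1, ff (qc x 1)) := by rw [hff1]
        rw [e1, hP_real, hP_fake x _ (by omega), if_pos hi0, hffv,
          show rr x - 2 - (rr x - 3 - 1) = 1 + 1 by omega, hB_zero, pv_eq, tsymm_qc]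
      · have hi2 : 2 ≤ ind x ∧ ind x ≤ rr x - 2 := by
          by_contra h
          rw [hffx, if_neg hi0, if_neg h] at hffpos
          exact lt_irrefl _ hffpos
        have hffv : ff x = 1 := by rw [hffx, if_neg hi0, if_pos hi2]
        rw [hffv, hP_fake x 0 (by omega), if_neg hi0]
        by_cases hlast : ind x = rr x - 2
        · -- LHS real at `qc x (rr x - 1)`, RHS via `pv (apex x)`
          have hffl : ff (qc x (ind x + 1)) = 0 := by
            rw [hffq, Nat.mod_eq_of_lt (by omega), if_neg (by omega), if_neg (by omega)]
          rw [← hffl, hP_real, hlast, show rr x - 2 - (rr x - 2) = 0 by omega, hB_zero, pv_eq,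
            hq7]
          have e : ((finRotate N).trans π).symm (qc x 0) = qc x (rr x - 2 + 1) := by
            rw [Equiv.symm_apply_eq, hq3, show rr x - 2 + 1 + 1 = rr x by omega, hper0]
          rw [e]
        · have hffl : ff (qc x (ind x + 1)) = 1 := by
            rw [hffq, Nat.mod_eq_of_lt (by omega), if_neg (by omega), if_pos (by omega)]
          rw [hP_fake _ _ (by rw [hffl]; omega), hindq, Nat.mod_eq_of_lt (by omega),
            if_neg (by omega), hapq, hrrq, hB_pos _ _ (by omega), hq7]
          ext <;> simp; omega
  · ----- fake token
    have hslt : s < ff x := lt_of_le_of_ne hs hreal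
    by_cases hi0 : ind x = 0
    · -- apex fake
      have hffv : ff x = rr x - 3 := by rw [hffx, if_pos hi0]
      have hr4 : 4 ≤ rr x := by omega
      set j := rr x - 2 - s with hj
      have hj2 : 2 ≤ j ∧ j ≤ rr x - 2 := by omega
      have hffj : ff (qc x j) = 1 := by
        rw [hffq, Nat.mod_eq_of_lt (by omega), if_neg (by omega), if_pos hj2]
      -- LHS
      have hL : Pf (Sf (Pf (x, s))) = (zc (qc x j), ff (zc (qc x j))) := by
        rw [hP_fake x s hslt, if_pos hi0, ← hj, hS_fake _ _ (by rw [hffj]; omega), Nat.zero_add,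
          ← hffj, hP_real]
      rw [hL]
      by_cases hs0 : s = 0
      · subst hs0
        have hjv : j = rr x - 2 := by rw [hj]; omega
        rw [hB_zero, hP_real, zc_pv x hx, htsx, hi0, Nat.zero_add]
        have hffl : ff (qc x (rr x - 1)) = 0 := by
          rw [hffq, Nat.mod_eq_of_lt (by omega), if_neg (by omega), if_neg (by omega)]
        rw [hffl, hB_zero, pv_eq, hjv]
        have e : ((finRotate N).trans π).symm (qc x (rr x - 1)) = qc x (rr x - 2) := by
          rw [show rr x - 1 = (rr x - 2) + 1 by omega]; exact tsymm_qc _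
        rw [e]
      · have hspos : 0 < s := Nat.pos_of_ne_zero hs0
        rw [hB_pos _ _ hspos, hP_fake x (s - 1) (by omega), if_pos hi0,
          show rr x - 2 - (s - 1) = j + 1 by omega]
        have hffj1 : ff (qc x (j + 1)) = 1 := by
          rw [hffq, Nat.mod_eq_of_lt (by omega), if_neg (by omega), if_pos (by omega)]
        rw [hB_zero, pv_eq, tsymm_qc]
    · -- middle fake: `ff x = 1`, `s = 0`
      have hi2 : 2 ≤ ind x ∧ ind x ≤ rr x - 2 := by
        by_contra h
        rw [hffx, if_neg hi0, if_neg h] at hslt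
        exact Nat.not_lt_zero _ hslt
      have hffv : ff x = 1 := by rw [hffx, if_neg hi0, if_pos hi2]
      have hs0 : s = 0 := by omega
      subst hs0
      have hff0' : ff (qc x 0) = rr x - 3 := by rw [hffq, Nat.zero_mod, if_pos rfl]
      -- RHS = Sb (qc x (ind x - 1), ff (qc x (ind x - 1)))
      have hR : Sb (Pf (Sb (x, 0))) = Sb (qc x (ind x - 1), ff (qc x (ind x - 1))) := by
        rw [hB_zero, hP_real, zc_pv x hx, htsx]
        have e : qc x (ind x + rr x - 1) = qc x (ind x - 1) := by
          rw [hq4, show ind x + rr x - 1 = (ind x - 1) + rr x by omega, Nat.add_mod_right]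
        rw [e]
      rw [hR, hP_fake x 0 (by omega), if_neg hi0, hq7]
      by_cases hi2' : ind x = 2
      · -- `(qc x 0, rr x - 4) ↦ Sf ↦ (qc x 0, rr x - 3)` real
        rw [hi2', hS_fake _ _ (by rw [hff0']; omega), show rr x - 2 - 2 + 1 = rr x - 3 by omega,
          ← hff0', hP_real]
        have hff1 : ff (qc x (2 - 1)) = 0 := by
          rw [hffq, Nat.mod_eq_of_lt (by omega), if_neg (by omega), if_neg (by omega)]
        rw [hff1, hB_zero, pv_eq, show (2 : ℕ) - 1 = 0 + 1 by rfl, tsymm_qc]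
      · have hi3 : 3 ≤ ind x := by omega
        rw [hS_fake _ _ (by rw [hff0']; omega), hP_fake _ _ (by rw [hff0']; omega), hindq,
          Nat.zero_mod, if_pos rfl, hqq, hrrq, show rr x - 2 - (rr x - 2 - ind x + 1) = ind x - 1 by omega]
        have hffm : ff (qc x (ind x - 1)) = 1 := by
          rw [hffq, Nat.mod_eq_of_lt (by omega), if_neg (by omega), if_pos (by omega)]
        rw [hffm, hB_pos _ _ Nat.one_pos]

end FanTokens

end Literature.GroupTheory.CombinatorialGroupTheory

end
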